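import Mathlib
import HarnessLib
import Summits.ResolutionOfSingularities.ResolutionOfSingularities.Theorems.WildQuotientsWildQuotientResolutionS1aTriangularShiftKillsIn

/-!
# S1a — RANK-2 TRANSLATIONS WITH MONOMIAL DIRECTION IDEAL `(x₀^a, x₁^b)` are ONE-SHOT root kills (every `a, b ≥ 1`, every prime `p`)

[OURS · L1 W4.5c · leafhand-res-wildquotients-9 g1; corollary of ✓`triangularShift_killsIn_one` (`…S1aTriangularShiftKillsIn`); SUCCESSOR-BRIEF-v2 ADDENDUM v2f REV d §7.2
(`r = 0` translation stratum = plane principalization of the direction ideal)] — NOT statements of the manuscript; counted 0; AI-level work, weaker than expert review.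
Crux stmt-ResolutionOfSingularities-17941 `CyclicQuotientFourfolds`, line `s1a-logminvertex` v13 (`stub_reachLowerInFX`). A FAMILY OF RUNGS of the research stub, not the stub.

Companion of `translationRankTwo_terminal_initial` (`…S1aTranslationTerminalMv`, appendix: PRINCIPAL direction ideal ⇒ terminal at move 0). Here the direction
ideal is the NON-principal monomial ideal `(x₀^a, x₁^b)`: σ fixes `x₀, x₁` and translates `x₂ ↦ x₂ + x₀^a`, `x₃ ↦ x₃ + x₁^b`. ONE weighted blow-up of the
centre `(x₀ : b, x₁ : a)` with shift `δ = ab` — the toric principalization of `(x₀^a, x₁^b)` — kills it: (T1δ) rows `x₀^a, x₁^b ∈ 𝒥_{ab}` of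
`𝒥 = 𝒥((x₀ : b), (x₁ : a))`, (T2) `(x₀, x₁)^N ≤ (x₀^a, x₁^b) = augIdeal σ` (isolation — this is what FAILS for perturbations like `x₀^a(1 − x₀)`, whose fixed
locus has a second component), (T3δ) power chains `x₀^a = σx₂ − x₂`, `x₁^b = σx₃ − x₃` with `u = x₂, x₃ ∈ 𝒥₀`, `m = a, b`.
* ★ `translationRankTwoMonomial_killsIn_one` — `KillsIn 1 (initial)` for the whole family;
* `exists_reachLowerF_initial_of_translationRankTwoMonomial` — the conclusion of `ReachLowerInF(X)`, every root decoration.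
With the principal case (0 moves) and this monomial case (1 move), the `r = 0` rank-2 stratum's residual is the direction ideal `(F, G) ⊆ k[x₀, x₁]` needing
≥ 2 plane blow-ups to principalize (e.g. `(x₀², x₁(x₀ + x₁²))`) — expected `KillsIn (principalization depth)`; design of record, not claimed. (The order-`p`
hypothesis on the census germ is automatic here: `σ^p xᵢ = xᵢ + p·(…) = xᵢ`, every `p`.)
-/

set_option linter.dupNamespace false

noncomputable section

open CategoryTheory Limits AlgebraicGeometry TopologicalSpace Topology Opposite MvPolynomial
open Literature.AlgebraicGeometry.Resolution Literature.AlgebraicGeometry.RelativeSpec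
open Summit.ResolutionOfSingularities.ResolutionOfSingularities.Theorems.WildQuotientResolution.S1
open Summit.ResolutionOfSingularities.ResolutionOfSingularities.Theorems.WildQuotientResolution.S1.NodeAtlas
open Summit.ResolutionOfSingularities.ResolutionOfSingularities.Theorems.WildQuotientResolution.S1.KillCert
open Summit.ResolutionOfSingularities.ResolutionOfSingularities.Theorems.WildQuotientResolution.S1.GoodCharts
open Summit.ResolutionOfSingularities.ResolutionOfSingularities.Theorems.WildQuotientResolution.S1.NpFrame

namespace Summit.ResolutionOfSingularities.ResolutionOfSingularities.Theorems.WildQuotientResolution.S1.GameFrame.GModel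

open KillCert

variable {p : ℕ} {X' X₁ : Scheme.{0}} {q : X' ⟶ X₁} {G : Type} [Group G] {ρ : G →* Aut X'} {g₀ : G}

/-- ★ **RANK-2 TRANSLATIONS WITH MONOMIAL DIRECTION IDEAL ARE ONE-SHOT KILLS** (σ: x₂ ↦ x₂ + x₀^a, x₃ ↦ x₃ + x₁^b, x₀, x₁ fixed; `a, b ≥ 1`):
centre `(x₀ : b, x₁ : a)`, `δ = ab`, power chains `x₀^a = σx₂ − x₂`, `x₁^b = σx₃ − x₃`. Every `p`.
[OURS · L1 W4.5c · one-shot class with shift, `r = 0` rank-2 monomial direction; NOT a statement of the manuscript] -/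
theorem translationRankTwoMonomial_killsIn_one [Finite G] (hp : p.Prime) (hG : ∀ g : G, g ∈ Subgroup.zpowers g₀) (hg₀ : g₀ ^ p = 1)
    (hq : ∀ g : G, (ρ g).hom ≫ q = q) [IsIntegral X'] [IsLocallyNoetherian X'] [X'.IsSeparated] [IsAffine X'] [X₁.IsSeparated] [IsFinite q]
    (hreg : Scheme.IsRegular X') {k' : Type} [Field k'] (φ : X₁ ⟶ Spec (.of k')) [LocallyOfFiniteType φ]
    {k : Type} [Field k] (σ : MvPolynomial (Fin 4) k ≃+* MvPolynomial (Fin 4) k) (hC : ∀ a : k, σ (C a) = C a)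
    (a b : ℕ) (ha : 1 ≤ a) (hb : 1 ≤ b)
    (h0 : σ (X 0) = X 0) (h1 : σ (X 1) = X 1) (h2 : σ (X 2) = X 2 + X 0 ^ a) (h3 : σ (X 3) = X 3 + X 1 ^ b)
    (e : Γ(X', ⊤) ≃+* MvPolynomial (Fin 4) k)
    (hστ : ∀ t : Γ(X', ⊤), e ((ρ g₀⁻¹).hom.appLE ⊤ ⊤ (by rw [Scheme.Hom.preimage_top]) t) = σ (e t))
    (h₀ : NodeAtlas p (⟨ρ, hq⟩ : ActionOver q G) g₀) :
    KillsIn 1 (GModel.initial (p := p) (g₀ := g₀) hq h₀) := by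
  let v : Fin 2 → Fin 4 := ![0, 1]
  let w : Fin 2 → ℕ := ![b, a]
  have hv : Function.Injective v := by decide
  have hw0 : w 0 = b := rfl
  have hw1 : w 1 = a := rfl
  have hX0a : (X 0 : MvPolynomial (Fin 4) k) ^ a ∈ (weightedFiltration (X ∘ v : Fin 2 → MvPolynomial (Fin 4) k) w).ideal (a * b) := by
    have := pow_mem_weightedFiltration_ideal (X ∘ v : Fin 2 → MvPolynomial (Fin 4) k) w 0 a
    rwa [hw0] at this
  have hX1b : (X 1 : MvPolynomial (Fin 4) k) ^ b ∈ (weightedFiltration (X ∘ v : Fin 2 → MvPolynomial (Fin 4) k) w).ideal (a * b) := by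
    have := pow_mem_weightedFiltration_ideal (X ∘ v : Fin 2 → MvPolynomial (Fin 4) k) w 1 b
    rwa [hw1, mul_comm] at this
  have hinc0 : σ (X 0) - X 0 = 0 := by rw [h0, sub_self]
  have hinc1 : σ (X 1) - X 1 = 0 := by rw [h1, sub_self]
  have hinc2 : σ (X 2) - X 2 = X 0 ^ a := by rw [h2]; ring
  have hinc3 : σ (X 3) - X 3 = X 1 ^ b := by rw [h3]; ring
  refine triangularShift_killsIn_one hp hG hg₀ hq hreg φ σ hC (by norm_num : 0 < 2) v hv w
    (fun l => by fin_cases l <;> simp [w] <;> omega) (a * b) ?_ ?_ ?_ ?_ e hστ h₀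
  · intro i
    fin_cases i
    · change σ (X 0) - X 0 ∈ _; rw [hinc0]; exact Ideal.zero_mem _
    · change σ (X 1) - X 1 ∈ _; rw [hinc1]; exact Ideal.zero_mem _
    · change σ (X 2) - X 2 ∈ _; rw [hinc2]; exact hX0a
    · change σ (X 3) - X 3 ∈ _; rw [hinc3]; exact hX1b
  · intro l
    fin_cases l
    · change σ (X 0) - X 0 ∈ _; rw [hinc0]; exact Ideal.zero_mem _
    · change σ (X 1) - X 1 ∈ _; rw [hinc1]; exact Ideal.zero_mem _
  · refine exists_span_pow_le_of_pow_mem _ _ fun l => ?_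
    fin_cases l
    · refine ⟨a, ?_⟩; change (X 0 : MvPolynomial (Fin 4) k) ^ a ∈ _
      rw [← hinc2]; exact sub_mem_augmentationIdeal σ _
    · refine ⟨b, ?_⟩; change (X 1 : MvPolynomial (Fin 4) k) ^ b ∈ _
      rw [← hinc3]; exact sub_mem_augmentationIdeal σ _
  · intro l
    fin_cases l
    · refine ⟨a, X 2, 1, ha, ?_, isUnit_one, ?_, ?_⟩
      · change a * b ≤ a * b; exact le_rfl
      · change (X 2 : MvPolynomial (Fin 4) k) ∈ (weightedFiltration (X ∘ v : Fin 2 → MvPolynomial (Fin 4) k) w).ideal (a * b - a * b)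
        rw [Nat.sub_self]; exact mem_weightedFiltration_zero _ w _
      · change σ (X 2) - X 2 - 1 * X 0 ^ a ∈ (weightedFiltration (X ∘ v : Fin 2 → MvPolynomial (Fin 4) k) w).ideal (a * b + 1)
        have e1 : σ (X 2) - X 2 - 1 * X 0 ^ a = 0 := by rw [hinc2]; ring
        rw [e1]; exact Ideal.zero_mem _
    · refine ⟨b, X 3, 1, hb, ?_, isUnit_one, ?_, ?_⟩
      · change a * b ≤ b * a; rw [mul_comm]
      · change (X 3 : MvPolynomial (Fin 4) k) ∈ (weightedFiltration (X ∘ v : Fin 2 → MvPolynomial (Fin 4) k) w).ideal (b * a - a * b)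
        rw [mul_comm, Nat.sub_self]; exact mem_weightedFiltration_zero _ w _
      · change σ (X 3) - X 3 - 1 * X 1 ^ b ∈ (weightedFiltration (X ∘ v : Fin 2 → MvPolynomial (Fin 4) k) w).ideal (b * a + 1)
        have e1 : σ (X 3) - X 3 - 1 * X 1 ^ b = 0 := by rw [hinc3]; ring
        rw [e1]; exact Ideal.zero_mem _


/-- **The monomial rank-2 translation family satisfies the conclusion of `ReachLowerInF(X)`** at its initial model with ANY root decoration `𝔄₀`
(`exists_reachLowerF_of_killsIn_datum` on `translationRankTwoMonomial_killsIn_one`). [OURS · L1 W4.5c; NOT a statement of the manuscript] -/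
theorem exists_reachLowerF_initial_of_translationRankTwoMonomial [Finite G] (hp : p.Prime) (hG : ∀ g : G, g ∈ Subgroup.zpowers g₀) (hg₀ : g₀ ^ p = 1)
    (hq : ∀ g : G, (ρ g).hom ≫ q = q) [IsIntegral X'] [IsLocallyNoetherian X'] [X'.IsSeparated] [IsAffine X'] [X₁.IsSeparated] [IsFinite q]
    (hreg : Scheme.IsRegular X') {k' : Type} [Field k'] (φ : X₁ ⟶ Spec (.of k')) [LocallyOfFiniteType φ]
    {k : Type} [Field k] (σ : MvPolynomial (Fin 4) k ≃+* MvPolynomial (Fin 4) k) (hC : ∀ a : k, σ (C a) = C a)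
    (a b : ℕ) (ha : 1 ≤ a) (hb : 1 ≤ b)
    (h0 : σ (X 0) = X 0) (h1 : σ (X 1) = X 1) (h2 : σ (X 2) = X 2 + X 0 ^ a) (h3 : σ (X 3) = X 3 + X 1 ^ b)
    (e : Γ(X', ⊤) ≃+* MvPolynomial (Fin 4) k)
    (hστ : ∀ t : Γ(X', ⊤), e ((ρ g₀⁻¹).hom.appLE ⊤ ⊤ (by rw [Scheme.Hom.preimage_top]) t) = σ (e t))
    (h₀ : NodeAtlas p (⟨ρ, hq⟩ : ActionOver q G) g₀) (𝔄₀ : NodeAtlasData p (GModel.initial hq h₀).act g₀) :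
    ∃ P : ∀ M : GModel p q G ρ g₀, NodeAtlasData p M.act g₀ → Prop,
      P (GModel.initial hq h₀) 𝔄₀ ∧ ∀ (M : GModel p q G ρ g₀) (𝔄 : NodeAtlasData p M.act g₀), P M 𝔄 → ¬ M.Terminal →
        ∃ n : ℕ, TreeF P (fun N 𝔅 => LexLTF N 𝔅 M 𝔄) n M 𝔄 :=
  exists_reachLowerF_of_killsIn_datum hp hG φ (GModel.initial hq h₀) 𝔄₀
    (translationRankTwoMonomial_killsIn_one hp hG hg₀ hq hreg φ σ hC a b ha hb h0 h1 h2 h3 e hστ h₀)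

end Summit.ResolutionOfSingularities.ResolutionOfSingularities.Theorems.WildQuotientResolution.S1.GameFrame.GModel

end
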